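import Summits.CriticalPhenomena.SAWScalingLimit.Theorems.SAWLoopFugacityFlowAvoidanceDeterminesLaw
import Summits.CriticalPhenomena.SAWScalingLimit.Theorems.SAWDevelopingMapObservableToSLERestrictionIdentifiesHulls
import Summits.CriticalPhenomena.SAWScalingLimit.Theorems.SAWDevelopingMapHexConjectureRangeIdentificationFill
import Literature.Probability.RandomPlanarGeometry.RestrictionHullsRiemannProofs
import Literature.Probability.RandomPlanarGeometry.RestrictionHullsProofs
import Literature.MeasureTheory.RandomSets.AvoidanceFunctional
import Mathlib.Topology.Sets.VietorisTopology

/-!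
# Crux `HexConjecture` (stmt-CriticalPhenomena-0808), line `root-locality-replaces-loewner`,
stub `stub_rangeIdentification`: the AVOIDANCE IDENTITY for subsequential limits of the range
laws (part 2b)

Landing target:
`Summits/CriticalPhenomena/SAWScalingLimit/Theorems/SAWDevelopingMapHexConjectureRangeIdentificationAvoid.lean`
(`--supports stmt-CriticalPhenomena-0808`).

Let `(D; a, b)` be a Dobrushin domain, `φ` a chordal uniformizing map with boundary extension
`ψ`, `μ` a finite law on curve classes carried by the chordal carrier of `D` whose probability of
avoiding `ψ(A)` is `Φ'_A(0)^{5/8}` for every `*`-hull `A` (the chordal SLE(8/3) law through `φ`,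
`exists_sleLaw_through`), and `ν` a finite law on `NonemptyCompacts ℂ` carried by connected
compact sets `K ⊆ cl D` containing `a, b` and meeting `∂D` only at `a, b`, such that

* (H1) `μ {range ⊆ cl D'} ≤ ν {K ⊆ cl D'}` for every hull subdomain `D'` of `D`, and
* (H2) `ν {K ∩ S = ∅} ≤ μ {range ⊆ cl D'}` for every closed `S` with `cl D ∖ S ⊆ cl D'`

(the two portmanteau inequalities a subsequential limit of the RANGE laws of the critical
hexagonal SAW inherits from the avoidance cocycle, parts 1b, 2c).  THEN for every closed bounded
`T ⊆ cl ℍ` with `0 ∉ T` and `T ∪ {Im ≤ 0}` connected (anchored test sets and their finite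
unions):  `ν {K ∩ ψ(T) = ∅} = μ {range ∩ ψ(T) = ∅}` (`measure_setOf_disjoint_image_eq`, registered
as `rangeIdentification_avoid`).

Proof — [LSW] Lemma 3.2's squeeze through hull subdomains, for random compact sets.  If
`0 ∈ hpFill T` no carrier set avoids `ψ(T)` (fill lemma, part 2a) and both sides vanish.
Otherwise `A = hpFill T` is a `*`-hull, carrier sets avoiding `ψ(T)` avoid `ψ(A)` (fill lemma),
`μ {avoid ψ(A)} = Φ'_A(0)^{5/8} > 0` provides a chord whose pulled-back configuration avoids `A`,
and the hull subdomains `D_j` of `exists_isHullSubdomain_squeeze` (crux item stmt-1373) satisfy: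
(L1) a carrier set inside `cl D_j` avoids `ψ(T)`; (L2) `cl D ∖ ψ(S_j) ⊆ cl D_j` for the compact
level sets `S_j = {Im ≥ 0, dist(·, A ∪ [-R,-c] ∪ [c,R]) ≤ c/(j+2)}`; (U) a CLOSED carrier set
avoiding `ψ(T)` avoids some `ψ(S_j)` (its pulled-back set is closed, meets `ℝ` only at `0`, and
avoids the compact `A ∪ [-R,-c] ∪ [c,R]`).  Hence
`μ{avoid} = sup_j μ{avoid S_j} ≤ sup_j μ{⊆ cl D_j} ≤ sup_j ν{⊆ cl D_j} ≤ ν{avoid}` (H1, L2, L1) and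
`ν{avoid} = sup_j ν{avoid S_j} ≤ sup_j μ{⊆ cl D_j} ≤ μ{avoid}` (U, H2 with L2, L1).

References: G. F. Lawler, O. Schramm, W. Werner, *Conformal restriction: the chordal case*,
J. Amer. Math. Soc. **16** (2003), Lemma 3.2 (p. 10), Lemma 2.1 (p. 8), Thm. 6.1.
-/

noncomputable section

namespace Summit.CriticalPhenomena.SAWScalingLimit.Theorems.HexConjecture.RootLocality.Range

open scoped Topology NNReal ENNReal
open Filter Set Metric Bornology MeasureTheory TopologicalSpace
open UpperHalfPlane (upperHalfPlaneSet isOpen_upperHalfPlaneSet)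
open Literature.Probability.RandomPlanarGeometry
open Summit.CriticalPhenomena.SAWScalingLimit.Theorems.AvoidanceDeterminesLaw
  (exists_isHullSubdomain_squeeze isCompact_levelSet setOf_im_nonneg_subset_closure)

variable {D : DobrushinDomain} {φ : ConformalEquiv upperHalfPlaneSet D.carrier}

/-! ### Carrier sets: chords are carrier sets -/

/-- The trace of a class of the chordal carrier is a closed carrier set: in `cl D`, preconnected,
containing both marked points and meeting `∂D` only at them. [folklore] -/
theorem carrier_of_mem_chordalCarrier {c : CurveClass ℂ} (hc : c ∈ chordalCarrier D) :
    c.range ⊆ closure D.carrier ∧ IsPreconnected c.range ∧ D.pt 0 ∈ c.range ∧ D.pt 1 ∈ c.range ∧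
      c.range ∩ frontier D.carrier ⊆ {D.pt 0, D.pt 1} := by
  obtain ⟨⟨⟨-, hsrc⟩, htgt⟩, hr⟩ := hc
  refine ⟨subset_closure_of_subset_carrier_union hr, ?_, ?_, ?_, ?_⟩
  · obtain ⟨γ, rfl⟩ := CurveClass.surjective_mk c
    rw [CurveClass.range_mk]
    exact isPreconnected_range γ.continuous
  · rw [← show c.source = D.pt 0 from hsrc]; exact c.source_mem_range
  · rw [← show c.target = D.pt 1 from htgt]; exact c.target_mem_range
  · rintro x ⟨hx, hxfr⟩
    rcases hr hx with hxD | hxab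
    · exact absurd (by rwa [D.isOpen.interior_eq]) hxfr.2
    · exact hxab

/-! ### The two halves of the squeeze on carrier sets -/

section Squeeze

variable {K T A : Set ℂ}

/-- **(L1) A carrier set inside `cl D'`, where `A ∩ ℍ` is off `cl φ⁻¹(D')` and `A ⊇ T ∩ ℍ`,
`0 ∉ A ∪ T`, avoids `ψ(T)`.** [cite: LawlerSchrammWerner2003Restriction, Lemma 3.2 (p. 10), transposed] -/
theorem disjoint_image_of_subset_closure (hC : JordanDomain.exists_continuousOn_extension)
    (hφ : D.IsChordalUniformizing φ) (hKfr : K ∩ frontier D.carrier ⊆ {D.pt 0, D.pt 1})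
    {D' : DobrushinDomain} (hD' : D.IsHullSubdomain D')
    (hoff : Disjoint (A ∩ upperHalfPlaneSet) (closure (φ.pullbackDomain D')))
    (hTcl : T ⊆ closure upperHalfPlaneSet) (hTA : T ∩ upperHalfPlaneSet ⊆ A) (h0T : (0 : ℂ) ∉ T)
    (hKD' : K ⊆ closure D'.carrier) : Disjoint K (φ.boundaryExtension '' T) := by
  rw [disjoint_image_iff_disjoint_pullbackSet hTcl]
  refine Set.disjoint_left.2 ?_
  rintro z ⟨hzim, hzK⟩ hzT
  rcases hzim.lt_or_eq with hpos | hzero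
  · have hzH : z ∈ upperHalfPlaneSet := hpos
    rw [φ.boundaryExtension_eq hzH] at hzK
    have hzcl : z ∈ closure (φ.pullbackDomain D') :=
      ConformalEquiv.mem_closure_pullbackDomain_of_apply hzH hD'.carrier_subset (hKD' hzK)
    exact Set.disjoint_left.1 hoff ⟨hTA ⟨hzT, hzH⟩, hzH⟩ hzcl
  · have hz0 : z = 0 := eq_zero_of_im_eq_zero_of_mem hC hφ hKfr hzero.symm hzK
    exact h0T (hz0 ▸ hzT)

/-- **(L2) `cl D ∖ ψ(S) ⊆ cl D'`** when every point of `ℍ ∖ φ⁻¹(D')` lies in `S ⊆ cl ℍ`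
(`D ∖ D' ⊆ ψ(S)`). [folklore] -/
theorem closure_diff_image_subset (hC : JordanDomain.exists_continuousOn_extension)
    {D' : DobrushinDomain} {S : Set ℂ} (hScl : S ⊆ closure upperHalfPlaneSet)
    (hScpt : IsCompact S) (hfar : ∀ z ∈ upperHalfPlaneSet, z ∉ S → z ∈ φ.pullbackDomain D') :
    closure D.carrier \ φ.boundaryExtension '' S ⊆ closure D'.carrier := by
  refine Summit.CriticalPhenomena.SAWScalingLimit.Theorems.ObservableToSLE.FloorRatio.closure_diff_subset
    (MarkedDomain.isCompact_image_boundaryExtension hC hScl hScpt).isClosed ?_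
  rintro w ⟨hwD, hwD'⟩
  have hz : φ.symm w ∈ upperHalfPlaneSet := φ.symm_mapsTo hwD
  have hzS : φ.symm w ∈ S := by
    by_contra h
    exact hwD' (by simpa [φ.apply_symm_apply hwD] using (hfar _ hz h).2)
  exact ⟨φ.symm w, hzS, by rw [φ.boundaryExtension_eq hz, φ.apply_symm_apply hwD]⟩

/-- **(U) A closed carrier set avoiding `ψ(A)` avoids `ψ` of a level set
`{Im ≥ 0, infDist(·, Q) ≤ ε}`, `Q = A ∪ [-R, -c] ∪ [c, R]`, for small `ε`**: its pulled-back set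
is closed, contains `0`, meets `ℝ` only at `0` and misses the compact `Q`.
[cite: LawlerSchrammWerner2003Restriction, Lemma 3.2 (p. 10), transposed] -/
theorem exists_disjoint_image_levelSet (hC : JordanDomain.exists_continuousOn_extension)
    (hφ : D.IsChordalUniformizing φ) (hKcl : IsClosed K) (h0K : D.pt 0 ∈ K)
    (hKfr : K ∩ frontier D.carrier ⊆ {D.pt 0, D.pt 1}) (hAcl : A ⊆ closure upperHalfPlaneSet)
    (hKA : Disjoint K (φ.boundaryExtension '' A)) {Q : Set ℂ} (hQc : IsCompact Q)
    (hQne : Q.Nonempty) (hQA : ∀ q ∈ Q, q ∈ A ∨ (q.im = 0 ∧ q ≠ 0)) {ε : ℕ → ℝ}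
    (hε : Tendsto ε atTop (𝓝 0)) :
    ∃ j, Disjoint K (φ.boundaryExtension '' {z : ℂ | 0 ≤ z.im ∧ infDist z Q ≤ ε j}) := by
  set K' : Set ℂ := {z : ℂ | 0 ≤ z.im ∧ φ.boundaryExtension z ∈ K} with hK'
  have hK'cl : IsClosed K' := isClosed_pullbackSet hC hKcl
  have h0K' : (0 : ℂ) ∈ K' := by
    refine ⟨le_rfl, ?_⟩
    rw [φ.boundaryExtension_eq_of_hasBoundaryValue (mem_closure_upperHalfPlaneSet_iff.2 le_rfl) hφ.1]
    exact h0K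
  have hKA' : Disjoint K' A := (disjoint_image_iff_disjoint_pullbackSet hAcl).1 hKA
  have hdisjQ : Disjoint K' Q := by
    refine Set.disjoint_left.2 fun z hz hzQ => ?_
    rcases hQA z hzQ with hzA | ⟨hzim, hz0⟩
    · exact Set.disjoint_left.1 hKA' hz hzA
    · exact hz0 (eq_zero_of_im_eq_zero_of_mem hC hφ hKfr hzim hz.2)
  -- a uniform positive distance from `Q` to `K'`
  obtain ⟨δ, hδ, hδQ⟩ : ∃ δ : ℝ, 0 < δ ∧ ∀ q ∈ Q, δ ≤ infDist q K' := by
    obtain ⟨q₀, hq₀, hmin⟩ := hQc.exists_isMinOn hQne (continuous_infDist_pt K').continuousOn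
    refine ⟨infDist q₀ K', ?_, fun q hq => hmin hq⟩
    exact (hK'cl.notMem_iff_infDist_pos ⟨0, h0K'⟩).1 fun h => Set.disjoint_left.1 hdisjQ h hq₀
  obtain ⟨j, hj⟩ : ∃ j, ε j < δ := ((tendsto_order.1 hε).2 δ hδ).exists
  refine ⟨j, (disjoint_image_iff_disjoint_pullbackSet fun z hz =>
    setOf_im_nonneg_subset_closure hz.1).2 (Set.disjoint_left.2 fun z hz hzS => ?_)⟩
  have h1 : δ ≤ infDist z Q := (le_infDist hQne).2 fun q hq => by
    rw [dist_comm]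
    exact (hδQ q hq).trans (infDist_le_dist_of_mem hz)
  linarith [hzS.2]

end Squeeze

/-! ### The avoidance identity -/

section Identity

variable [MeasurableSpace (NonemptyCompacts ℂ)]

/-- **The avoidance identity** (module docstring): under (H1), (H2) and the carrier hypotheses,
`ν {K ∩ ψ(T) = ∅} = μ {range ∩ ψ(T) = ∅}` for every closed bounded `T ⊆ cl ℍ` with `0 ∉ T` and
`T ∪ {Im ≤ 0}` connected.
[cite: LawlerSchrammWerner2003Restriction, Lemma 3.2 (p. 10) with Lemma 2.1 (p. 8) and Thm. 6.1, transposed] -/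
theorem measure_setOf_disjoint_image_eq (hφ : D.IsChordalUniformizing φ)
    {μ : Measure (CurveClass ℂ)} [IsFiniteMeasure μ] (hμcar : ∀ᵐ c ∂μ, c ∈ chordalCarrier D)
    (hμav : ∀ (A : Set ℂ) (Φ : ConformalEquiv (upperHalfPlaneSet \ A) upperHalfPlaneSet) (d : ℝ),
      IsStarHull A → IsRestrictionMap A Φ → HasRestrictionDeriv A Φ d →
      μ (CurveClass.rangeSubset (φ.boundaryExtension '' A)ᶜ) = ENNReal.ofReal (d ^ ((5 : ℝ) / 8)))
    {ν : Measure (NonemptyCompacts ℂ)} [IsFiniteMeasure ν]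
    (hνcar : ∀ᵐ (K : NonemptyCompacts ℂ) ∂ν, (K : Set ℂ) ⊆ closure D.carrier ∧
      IsPreconnected (K : Set ℂ) ∧ D.pt 0 ∈ (K : Set ℂ) ∧ D.pt 1 ∈ (K : Set ℂ) ∧
      (K : Set ℂ) ∩ frontier D.carrier ⊆ {D.pt 0, D.pt 1})
    (H1 : ∀ D' : DobrushinDomain, D.IsHullSubdomain D' →
      μ (CurveClass.rangeSubset (closure D'.carrier)) ≤ ν {K | (K : Set ℂ) ⊆ closure D'.carrier})
    (H2 : ∀ (D' : DobrushinDomain) (S : Set ℂ), D.IsHullSubdomain D' → IsClosed S →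
      closure D.carrier \ S ⊆ closure D'.carrier →
      ν {K | Disjoint (K : Set ℂ) S} ≤ μ (CurveClass.rangeSubset (closure D'.carrier)))
    {T : Set ℂ} (hTc : IsClosed T) (hTb : IsBounded T) (hTcl : T ⊆ closure upperHalfPlaneSet)
    (h0T : (0 : ℂ) ∉ T) (hTconn : IsConnected (T ∪ {z : ℂ | z.im ≤ 0})) :
    ν {K : NonemptyCompacts ℂ | Disjoint (K : Set ℂ) (φ.boundaryExtension '' T)} =
      μ (CurveClass.rangeSubset (φ.boundaryExtension '' T)ᶜ) := by
  classical
  have hC : JordanDomain.exists_continuousOn_extension := JordanDomain.exists_continuousOn_extension_holds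
  have hJarc : Literature.Topology.PlaneTopology.JordanArcSeparation :=
    Literature.Topology.PlaneTopology.JordanArcSeparation_holds
  have hFa : isSimplyConnected_of_isConnected_compl := isSimplyConnected_of_isConnected_compl_holds
  set ψ := φ.boundaryExtension with hψ
  set AvX : Set (NonemptyCompacts ℂ) := {K | Disjoint (K : Set ℂ) (ψ '' T)} with hAvX
  set AvC : Set (CurveClass ℂ) := CurveClass.rangeSubset (ψ '' T)ᶜ with hAvC
  have hAvC_iff : ∀ c : CurveClass ℂ, c ∈ AvC ↔ Disjoint c.range (ψ '' T) := fun c =>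
    CurveClass.disjoint_range_iff.symm
  -- trivial case: `0 ∈ hpFill T`
  by_cases h0A : (0 : ℂ) ∈ hpFill T
  · have hnoX : ν AvX = 0 := by
      rw [measure_eq_zero_iff_ae_notMem]
      filter_upwards [hνcar] with K hK hKav
      exact zero_notMem_hpFill_of_disjoint hC hφ hK.1 hK.2.1 hK.2.2.1 hK.2.2.2.1 hK.2.2.2.2 hTc
        h0T hKav h0A
    have hnoC : μ AvC = 0 := by
      rw [measure_eq_zero_iff_ae_notMem]
      filter_upwards [hμcar] with c hc hcav
      obtain ⟨h1, h2, h3, h4, h5⟩ := carrier_of_mem_chordalCarrier hc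
      exact zero_notMem_hpFill_of_disjoint hC hφ h1 h2 h3 h4 h5 hTc h0T ((hAvC_iff c).1 hcav) h0A
    rw [hnoX, hnoC]
  -- main case: `A = hpFill T` is a `*`-hull
  set A : Set ℂ := hpFill T with hAdef
  have hA : IsStarHull A := isStarHull_hpFill hFa hTc hTb hTconn h0A
  have hAc : IsCompact A := hA.isBoundedHull.isCompact
  have hAcl : A ⊆ closure upperHalfPlaneSet := hA.isBoundedHull.subset_closure
  have hTA : T ∩ upperHalfPlaneSet ⊆ A := inter_subset_hpFill T
  -- a chord avoiding `ψ(A)`, from the SLE(8/3) value, and its pulled-back configuration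
  obtain ⟨Φ, hΦ, -⟩ := IsStarHull.existsUnique_isRestrictionMap_holds hA
  obtain ⟨d, hd0, -, hd⟩ := IsStarHull.exists_hasRestrictionDeriv_holds hA hΦ
  have hpos : μ (CurveClass.rangeSubset (ψ '' A)ᶜ) ≠ 0 := by
    rw [hμav A Φ d hA hΦ hd]
    exact (ENNReal.ofReal_pos.2 (Real.rpow_pos_of_pos hd0 _)).ne'
  obtain ⟨c₀, hc₀, hc₀A⟩ : ∃ c₀ ∈ chordalCarrier D, c₀ ∈ CurveClass.rangeSubset (ψ '' A)ᶜ := by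
    by_contra hne
    push Not at hne
    exact hpos (measure_eq_zero_iff_ae_notMem.2 (hμcar.mono fun c hc h => hne c hc h))
  set K₀ : RestrictionConfig := pullbackConfig hJarc hC hφ c₀ with hK₀def
  have hK₀A : Disjoint (K₀ : Set ℂ) A := by
    rw [hK₀def, coe_pullbackConfig hc₀]
    exact (disjoint_pullbackTrace_iff_mem_rangeSubset hC hφ hc₀ hAcl hA.2).2 hc₀A
  -- constants `0 < c ≤ R` with `c ≤ ‖z‖ ≤ R` on `A`
  obtain ⟨c, hc, hcA⟩ : ∃ c : ℝ, 0 < c ∧ ∀ z ∈ A, c ≤ ‖z‖ := by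
    obtain ⟨c, hc, hball⟩ := Metric.isOpen_iff.1 hAc.isClosed.isOpen_compl 0 hA.2
    exact ⟨c, hc, fun z hz => not_lt.1 fun hlt => hball (by simpa using hlt) hz⟩
  obtain ⟨R₀, hR₀⟩ := hAc.isBounded.subset_closedBall 0
  set R : ℝ := max R₀ c with hRdef
  have hcR : c ≤ R := le_max_right _ _
  have hnorm : ∀ z ∈ A, c ≤ ‖z‖ ∧ ‖z‖ ≤ R := fun z hz => ⟨hcA z hz, by
    have := hR₀ hz
    rw [mem_closedBall, dist_zero_right] at this
    exact this.trans (le_max_left _ _)⟩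
  -- the compact set `Q = A ∪ [-R, -c] ∪ [c, R]` and the level sets `S j`
  set Q : Set ℂ := A ∪ (((↑) : ℝ → ℂ) '' Icc (-R) (-c) ∪ ((↑) : ℝ → ℂ) '' Icc c R) with hQdef
  have hQne : Q.Nonempty := ⟨(c : ℂ), Or.inr (Or.inr ⟨c, ⟨le_rfl, hcR⟩, rfl⟩)⟩
  have hQc : IsCompact Q := hAc.union ((isCompact_Icc.image Complex.continuous_ofReal).union
    (isCompact_Icc.image Complex.continuous_ofReal))
  have hQA : ∀ q ∈ Q, q ∈ A ∨ (q.im = 0 ∧ q ≠ 0) := by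
    rintro q (hq | ⟨x, hx, rfl⟩ | ⟨x, hx, rfl⟩)
    · exact Or.inl hq
    · refine Or.inr ⟨by simp, fun h => ?_⟩
      have : x = 0 := by exact_mod_cast h
      linarith [hx.2]
    · refine Or.inr ⟨by simp, fun h => ?_⟩
      have : x = 0 := by exact_mod_cast h
      linarith [hx.1]
  set ε : ℕ → ℝ := fun j => c / (j + 2) with hεdef
  have hεpos : ∀ j, 0 < ε j := fun j => by positivity
  have hεanti : Antitone ε := fun i j hij => by
    show c / (j + 2) ≤ c / (i + 2)
    gcongr
  have hεto : Tendsto ε atTop (𝓝 0) := by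
    have h1 : Tendsto (fun j : ℕ => ((j : ℝ) + 2)) atTop atTop :=
      tendsto_atTop_add_const_right _ _ tendsto_natCast_atTop_atTop
    simpa using h1.const_div_atTop c
  set S : ℕ → Set ℂ := fun j => {z : ℂ | 0 ≤ z.im ∧ infDist z Q ≤ ε j} with hSdef
  have hScl : ∀ j, S j ⊆ closure upperHalfPlaneSet := fun j z hz => setOf_im_nonneg_subset_closure hz.1
  have hScpt : ∀ j, IsCompact (S j) := fun j => isCompact_levelSet hQc.isBounded hQne (ε j)
  have hSclosed : ∀ j, IsClosed (ψ '' S j) := fun j =>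
    (MarkedDomain.isCompact_image_boundaryExtension hC (hScl j) (hScpt j)).isClosed
  set AvXj : ℕ → Set (NonemptyCompacts ℂ) := fun j => {K | Disjoint (K : Set ℂ) (ψ '' S j)} with hAvXj
  set AvCj : ℕ → Set (CurveClass ℂ) := fun j => CurveClass.rangeSubset (ψ '' S j)ᶜ with hAvCj
  have hSmono : ∀ {i j}, i ≤ j → S j ⊆ S i := fun hij z hz => ⟨hz.1, hz.2.trans (hεanti hij)⟩
  have hAvXjmono : Monotone AvXj := fun i j hij K hK =>
    Disjoint.mono_right (image_mono (hSmono hij)) hK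
  have hAvCjmono : Monotone AvCj := fun i j hij c' hc' => by
    rw [hAvCj] at hc' ⊢
    have h := CurveClass.disjoint_range_iff.2 hc'
    exact CurveClass.disjoint_range_iff.1 (h.mono_right (image_mono (hSmono hij)))
  -- (U): closed carrier sets avoiding `ψ(T)` avoid some `ψ(S j)`
  have hU : ∀ K : Set ℂ, IsClosed K → K ⊆ closure D.carrier → IsPreconnected K → D.pt 0 ∈ K →
      D.pt 1 ∈ K → K ∩ frontier D.carrier ⊆ {D.pt 0, D.pt 1} → Disjoint K (ψ '' T) →
      ∃ j, Disjoint K (ψ '' S j) := by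
    intro K hKcl hKD hKc h0K h1K hKfr hKT
    have hKA : Disjoint K (ψ '' A) := disjoint_image_hpFill hC hφ hKD hKc h0K h1K hKfr hTc hTb h0T hKT
    exact exists_disjoint_image_levelSet hC hφ hKcl h0K hKfr hAcl hKA hQc hQne hQA hεto
  -- (L): the squeezing hull subdomains
  have hL : ∀ j, ∃ D' : DobrushinDomain, D.IsHullSubdomain D' ∧
      (∀ K : Set ℂ, K ∩ frontier D.carrier ⊆ {D.pt 0, D.pt 1} → K ⊆ closure D'.carrier →
        Disjoint K (ψ '' T)) ∧
      closure D.carrier \ ψ '' S j ⊆ closure D'.carrier := by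
    intro j
    obtain ⟨D', hD', hoff, hfar⟩ := exists_isHullSubdomain_squeeze hφ hA K₀ hK₀A hc hnorm (hεpos j)
    refine ⟨D', hD', fun K hKfr hKD' =>
      disjoint_image_of_subset_closure hC hφ hKfr hD' hoff hTcl hTA h0T hKD', ?_⟩
    refine closure_diff_image_subset hC (hScl j) (hScpt j) fun z hz hzS => hfar z hz ?_
    exact not_lt.1 fun hlt => hzS ⟨le_of_lt (show (0 : ℝ) < z.im from hz), hlt.le⟩
  choose Dj hDj hDjT hDjS using hL
  -- the two chains of inequalities
  refine le_antisymm ?_ ?_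
  · -- `ν {avoid} ≤ μ {avoid}`
    have h1 : ν AvX ≤ ν (⋃ j, AvXj j) := by
      refine measure_mono_ae ?_
      filter_upwards [hνcar] with K hK hKav
      exact mem_iUnion.2 (hU (K : Set ℂ) K.isCompact.isClosed hK.1 hK.2.1 hK.2.2.1 hK.2.2.2.1
        hK.2.2.2.2 hKav)
    rw [hAvXjmono.measure_iUnion] at h1
    refine h1.trans (iSup_le fun j => ?_)
    calc ν (AvXj j) ≤ μ (CurveClass.rangeSubset (closure (Dj j).carrier)) :=
          H2 (Dj j) (ψ '' S j) (hDj j) (hSclosed j) (hDjS j)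
      _ ≤ μ AvC := by
          refine measure_mono_ae ?_
          filter_upwards [hμcar] with c' hc' hV
          have hV' : c'.range ⊆ closure (Dj j).carrier := hV
          exact (hAvC_iff c').2 (hDjT j c'.range (carrier_of_mem_chordalCarrier hc').2.2.2.2 hV')
  · -- `μ {avoid} ≤ ν {avoid}`
    have h1 : μ AvC ≤ μ (⋃ j, AvCj j) := by
      refine measure_mono_ae ?_
      filter_upwards [hμcar] with c' hc' hcav
      obtain ⟨hcD, hcc, hc0, hc1, hcfr⟩ := carrier_of_mem_chordalCarrier hc'
      obtain ⟨j, hj⟩ := hU c'.range c'.isCompact_range.isClosed hcD hcc hc0 hc1 hcfr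
        ((hAvC_iff c').1 hcav)
      exact mem_iUnion.2 ⟨j, CurveClass.disjoint_range_iff.1 hj⟩
    rw [hAvCjmono.measure_iUnion] at h1
    refine h1.trans (iSup_le fun j => ?_)
    calc μ (AvCj j) ≤ μ (CurveClass.rangeSubset (closure (Dj j).carrier)) := by
          refine measure_mono_ae ?_
          filter_upwards [hμcar] with c' hc' hcav
          change c'.range ⊆ closure (Dj j).carrier
          have hd' : Disjoint c'.range (ψ '' S j) := CurveClass.disjoint_range_iff.2 hcav
          exact fun x hx => hDjS j ⟨(carrier_of_mem_chordalCarrier hc').1 hx,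
            Set.disjoint_left.1 hd' hx⟩
      _ ≤ ν {K | (K : Set ℂ) ⊆ closure (Dj j).carrier} := H1 (Dj j) (hDj j)
      _ ≤ ν AvX := by
          refine measure_mono_ae ?_
          filter_upwards [hνcar] with K hK hKV
          exact hDjT j (K : Set ℂ) hK.2.2.2.2 hKV

end Identity

/-! ### Registered form (part 2b of `stub_rangeIdentification`) -/

/-- **Registered helper `rangeIdentification_avoid`** (crux item stmt-CriticalPhenomena-0808, line
`root-locality-replaces-loewner`, stub `stub_rangeIdentification`, part 2b): the avoidance
identity `ν {K ∩ ψ(T) = ∅} = μ {range ∩ ψ(T) = ∅}` for anchored half-plane test sets `T`, for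
every finite law `ν` on `NonemptyCompacts ℂ` carried by connected compact sets from `a` to `b` in
`cl D` meeting `∂D` only at `a, b` which satisfies the two portmanteau inequalities (H1), (H2)
against the chordal SLE(8/3) law `μ` of `D` read through `φ` ([LSW] Lemma 3.2's squeeze, for
random compact sets). [cite: LawlerSchrammWerner2003Restriction, Lemma 3.2 (p. 10), Lemma 2.1 (p. 8), Thm. 6.1, transposed] -/
theorem rangeIdentification_avoid : ∀ [MeasurableSpace (TopologicalSpace.NonemptyCompacts ℂ)] (D : Literature.Probability.RandomPlanarGeometry.DobrushinDomain) (φ : Literature.Probability.RandomPlanarGeometry.ConformalEquiv UpperHalfPlane.upperHalfPlaneSet D.carrier) (μ : MeasureTheory.Measure (Literature.Probability.RandomPlanarGeometry.CurveClass ℂ)) (ν : MeasureTheory.Measure (TopologicalSpace.NonemptyCompacts ℂ)) (T : Set ℂ), MeasureTheory.IsFiniteMeasure μ → MeasureTheory.IsFiniteMeasure ν → D.IsChordalUniformizing φ → (∀ᵐ c ∂μ, c ∈ Literature.Probability.RandomPlanarGeometry.chordalCarrier D) → (∀ (A : Set ℂ) (Φ : Literature.Probability.RandomPlanarGeometry.ConformalEquiv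 (UpperHalfPlane.upperHalfPlaneSet \ A) UpperHalfPlane.upperHalfPlaneSet) (d : ℝ), Literature.Probability.RandomPlanarGeometry.IsStarHull A → Literature.Probability.RandomPlanarGeometry.IsRestrictionMap A Φ → Literature.Probability.RandomPlanarGeometry.HasRestrictionDeriv A Φ d → μ (Literature.Probability.RandomPlanarGeometry.CurveClass.rangeSubset (φ.boundaryExtension '' A)ᶜ) = ENNReal.ofReal (d ^ ((5 : ℝ) / 8))) → (∀ᵐ (K : TopologicalSpace.NonemptyCompacts ℂ) ∂ν, (K : Set ℂ) ⊆ closure D.carrier ∧ IsPreconnected (K : Set ℂ) ∧ D.pt 0 ∈ (K : Set ℂ) ∧ D.pt 1 ∈ (K : Set ℂ) ∧ (K : Set ℂ) ∩ frontier D.carrier ⊆ {D.pt 0, D.pt 1}) → (∀ D' : Literature.Probability.RandomPlanarGeometry.DobrushinDomain, D.IsHullSubdomain D' → μ (Literature.Probability.RandomPlanarGeometry.CurveClass.rangeSubset (closure D'.carrier)) ≤ ν {K | (K : Set ℂ) ⊆ closure D'.carrier}) → (∀ (D' : Literature.Probability.RandomPlanarGeometry.DobrushinDomain) (S : Set ℂ),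 D.IsHullSubdomain D' → IsClosed S → closure D.carrier \ S ⊆ closure D'.carrier → ν {K | Disjoint (K : Set ℂ) S} ≤ μ (Literature.Probability.RandomPlanarGeometry.CurveClass.rangeSubset (closure D'.carrier))) → IsClosed T → Bornology.IsBounded T → T ⊆ closure UpperHalfPlane.upperHalfPlaneSet → (0 : ℂ) ∉ T → IsConnected (T ∪ {z : ℂ | z.im ≤ 0}) → ν {K : TopologicalSpace.NonemptyCompacts ℂ | Disjoint (K : Set ℂ) (φ.boundaryExtension '' T)} = μ (Literature.Probability.RandomPlanarGeometry.CurveClass.rangeSubset (φ.boundaryExtension '' T)ᶜ) :=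
  fun _ _ _ _ _ hμ hν hφ hμcar hμav hνcar H1 H2 hTc hTb hTcl h0T hTconn => by
    haveI := hμ; haveI := hν
    exact measure_setOf_disjoint_image_eq hφ hμcar hμav hνcar H1 H2 hTc hTb hTcl h0T hTconn

end Summit.CriticalPhenomena.SAWScalingLimit.Theorems.HexConjecture.RootLocality.Range

end
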